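import Summits.Ventures.PercRepro.ProfilePointedCircuitClassesStarNineParA
import Summits.Ventures.PercRepro.ProfilePointedCircuitClassesStarSevenFromSharpC

/-!
# PercRepro — THE PARALLEL-PAIR REGIME OF `StarNine`, PART B: THE THEOREM
(p5, gen 57; `proofs/P5-GM1.md` §85)

On a coloop-free matroid `N` with `#E = 9`, `ρ(E) = 5` and a parallel pair `x ∥ x′`, (★)₉ holds at every ordered
pair `e ≠ f`: every bi-independent `4`-set contains exactly one of `x, x′`, so every count splits along the pair
into counts of the two seven-point minors `N ／ x′ ∖ x` and `N ／ x ∖ x′` (rank `4`, coloop-free, with `x, x′` as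
spare points), where (★)₇ is the theorem `starSeven_of_seriesExt`.  The four positions of `{e, f}` relative to the
pair: both outside (`starNine_of_parallel_outside`: (★)₇ on both minors); `e = x` (`starNine_of_parallel_left`:
`in_4(x) = P_3` of the minor, `in_4(f) = 2 · thru_4({x, f})` by the swap, and the SUMMED (★)₇ gives
`out_3(f) ≤ 2 · in_3(f)` on the minor); `f = x` (`starNine_of_parallel_right`: `in_4(e) = 2 · thru_4({x, e})` and
`thru_4({x, e}) ≤ in_4(x)`); `{e, f} = {x, x′}` (`starNine_of_parallel_self`: `in_4(x) = in_4(x′)`).  Assembly: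
`starNine_of_parallel`.
-/

open scoped Matroid

namespace PercRepro.Cogirth

open Finset ThmH Skew Shadow Profile

open Classical

variable {α : Type} [DecidableEq α] {N : Matroid α} [N.Finite]

section StarNineParB

/-- `x ∉ {e, f}` from `e ≠ x` and `f ≠ x`. -/
theorem notMem_pair_of_ne {x e f : α} (hex : e ≠ x) (hfx : f ≠ x) : x ∉ ({e, f} : Finset α) := by
  rw [mem_insert, mem_singleton]
  rintro (h | h)
  · exact hex h.symm
  · exact hfx h.symm

/-- **THE MINOR ALONG A PARALLEL PAIR OF A COLOOP-FREE NINE-POINT RANK-5 MATROID**: `N ／ x′ ∖ x` has seven points,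
rank `4`, no coloop, and `x, x′` outside its ground set. -/
theorem minor_hyps_of_parallel (hn : (gr N).card = 9) (hR : rk N (gr N) = 5)
    (hcf : ∀ y ∈ gr N, rk N ((gr N).erase y) = 5) {x x' : α} (hx : x ∈ gr N) (hx' : x' ∈ gr N) (hxx' : x ≠ x')
    (hrx : rk N {x} = 1) (hrx' : rk N {x'} = 1) (hcl : x' ∈ clF N {x}) :
    gr ((N ／ ({x'} : Set α)) ＼ ({x} : Set α)) = ((gr N).erase x').erase x ∧
    (gr ((N ／ ({x'} : Set α)) ＼ ({x} : Set α))).card = 7 ∧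
    rk ((N ／ ({x'} : Set α)) ＼ ({x} : Set α)) (gr ((N ／ ({x'} : Set α)) ＼ ({x} : Set α))) = 4 ∧
    (∀ y ∈ gr ((N ／ ({x'} : Set α)) ＼ ({x} : Set α)),
      rk ((N ／ ({x'} : Set α)) ＼ ({x} : Set α)) ((gr ((N ／ ({x'} : Set α)) ＼ ({x} : Set α))).erase y) = 4) ∧
    Disjoint ((N ／ ({x'} : Set α)) ＼ ({x} : Set α)).E {x, x'} := by
  have hgr : gr ((N ／ ({x'} : Set α)) ＼ ({x} : Set α)) = ((gr N).erase x').erase x := by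
    rw [gr_delete', gr_contract']
  have hcard : (((gr N).erase x').erase x).card = 7 := by
    rw [card_erase_of_mem (mem_erase.2 ⟨hxx', hx⟩), card_erase_of_mem hx', hn]
  have hrk : rk ((N ／ ({x'} : Set α)) ＼ ({x} : Set α)) (((gr N).erase x').erase x) = 4 := by
    have h := rk_minor_add_one_of_nonloop (N := N) (s₁ := x) hrx'
      (subset_refl (((gr N).erase x').erase x))
    have e1 : insert x' (((gr N).erase x').erase x) = (gr N).erase x := by
      ext a
      simp only [mem_insert, mem_erase]
      constructor
      · rintro (rfl | ⟨hax, _, hag⟩)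
        · exact ⟨hxx'.symm, hx'⟩
        · exact ⟨hax, hag⟩
      · rintro ⟨hax, hag⟩
        by_cases h' : a = x'
        · exact Or.inl h'
        · exact Or.inr ⟨hax, h', hag⟩
    rw [e1, hcf x hx] at h
    omega
  have hcf7 : ∀ y ∈ ((gr N).erase x').erase x,
      rk ((N ／ ({x'} : Set α)) ＼ ({x} : Set α)) ((((gr N).erase x').erase x).erase y) = 4 := by
    intro y hy
    have h := rk_erase_minor_add_one_of_parallel (fun y hy => by rw [hcf y hy, hR]) hxx' hx hx' hrx hrx' hcl hy
    rw [hR] at h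
    omega
  refine ⟨hgr, by rw [hgr, hcard], by rw [hgr, hrk], by rw [hgr]; exact hcf7, ?_⟩
  rw [Set.disjoint_left]
  intro z hz hz'
  have hzg : z ∈ gr ((N ／ ({x'} : Set α)) ＼ ({x} : Set α)) := by rw [← mem_coe, coe_gr]; exact hz
  rw [hgr, mem_erase, mem_erase] at hzg
  rcases hz' with rfl | rfl
  · exact hzg.1 rfl
  · exact hzg.2.1 rfl

/-- **(★)₉ WITH A PARALLEL PAIR, BOTH POINTS OUTSIDE THE PAIR**: `in_4(e) ≤ in_4(f) + thru_4({e, f})` for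
`e ≠ f` outside `x ∥ x′` — the counts split along the pair and (★)₇ holds on both seven-point minors. -/
theorem starNine_of_parallel_outside (hn : (gr N).card = 9) (hR : rk N (gr N) = 5)
    (hcf : ∀ y ∈ gr N, rk N ((gr N).erase y) = 5) {x x' e f : α} (hx : x ∈ gr N) (hx' : x' ∈ gr N)
    (hxx' : x ≠ x') (hrx : rk N {x} = 1) (hrx' : rk N {x'} = 1) (hcl : x' ∈ clF N {x}) (he : e ∈ gr N)
    (hf : f ∈ gr N) (hef : e ≠ f) (hex : e ≠ x) (hex' : e ≠ x') (hfx : f ≠ x) (hfx' : f ≠ x') :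
    inCount N 4 e ≤ inCount N 4 f + thruCount N 4 {e, f} := by
  have hcl' : x ∈ clF N {x'} := mem_clF_singleton_of_parallel hx hx' hrx hrx' hcl
  have key : ∀ s t : α, s ∈ gr N → t ∈ gr N → s ≠ t → e ≠ s → e ≠ t → f ≠ s → f ≠ t → rk N {s} = 1 →
      rk N {t} = 1 → t ∈ clF N {s} →
      thruCount N 4 {s, e} ≤ thruCount N 4 {s, f} + thruCount N 4 (insert s {e, f}) := by
    intro s t hs ht hst hes het hfs hft hrs hrt htcl
    obtain ⟨hgr, hn7, hR4, hcf7, hdis⟩ := minor_hyps_of_parallel hn hR hcf hs ht hst hrs hrt htcl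
    have heM : e ∈ gr ((N ／ ({t} : Set α)) ＼ ({s} : Set α)) := by
      rw [hgr]; exact mem_erase.2 ⟨hes, mem_erase.2 ⟨het, he⟩⟩
    have hfM : f ∈ gr ((N ／ ({t} : Set α)) ＼ ({s} : Set α)) := by
      rw [hgr]; exact mem_erase.2 ⟨hfs, mem_erase.2 ⟨hft, hf⟩⟩
    have hstar := starSeven_of_seriesExt hdis hn7 hR4 hcf7 hst heM hfM hef
    rw [thruCount_pair_eq_inCount_of_parallel hes.symm hst het hs ht hrs hrt htcl (by norm_num),
      thruCount_pair_eq_inCount_of_parallel hfs.symm hst hft hs ht hrs hrt htcl (by norm_num),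
      thruCount_insert_eq_thruCount_minor_of_parallel hst hs ht hrs hrt htcl (notMem_pair_of_ne hes hfs)
        (notMem_pair_of_ne het hft) (by norm_num)]
    exact hstar
  have h1 := key x x' hx hx' hxx' hex hex' hfx hfx' hrx hrx' hcl
  have h2 := key x' x hx' hx hxx'.symm hex' hex hfx' hfx hrx' hrx hcl'
  rw [inCount_eq_thruCount_add_thruCount_of_parallel hx hx' hxx' hrx hcl (e := e) 4,
    inCount_eq_thruCount_add_thruCount_of_parallel hx hx' hxx' hrx hcl (e := f) 4,
    thruCount_eq_thruCount_insert_add_thruCount_insert_of_parallel hx hx' hxx' hrx hcl {e, f} 4]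
  omega

/-- **THE SUMMED FORM OF (★)₇**: on a coloop-free rank-4 matroid on seven points (two spare points outside),
`out_3(f) ≤ 2 · in_3(f)` — (★)₇ at `(e′, f)` summed over the six points `e′ ≠ f`. -/
theorem outCount_three_le_two_mul_inCount_of_seriesExt {R : Matroid α} [R.Finite] {b b' : α}
    (h : Disjoint R.E {b, b'}) (hn7 : (gr R).card = 7) (hR4 : rk R (gr R) = 4)
    (hcf7 : ∀ x ∈ gr R, rk R ((gr R).erase x) = 4) (hbb' : b ≠ b') {f : α} (hf : f ∈ gr R) :
    outCount R 3 f ≤ 2 * inCount R 3 f := by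
  have hsum : ∑ e' ∈ (gr R).erase f, inCount R 3 e' ≤
      ∑ e' ∈ (gr R).erase f, (inCount R 3 f + thruCount R 3 {e', f}) := by
    apply sum_le_sum
    intro e' he'
    exact starSeven_of_seriesExt h hn7 hR4 hcf7 hbb' (mem_erase.1 he').2 hf (mem_erase.1 he').1
  rw [sum_add_distrib, sum_const, smul_eq_mul, sum_thruCount_pair_erase, card_erase_of_mem hf, hn7] at hsum
  have h1 := sum_inCount_erase_add_inCount (N := R) 3 f
  have h2 := inCount_add_outCount R 3 f
  omega

/-- **(★)₉ WITH A PARALLEL PAIR, `e` IN THE PAIR**: `in_4(x) ≤ in_4(f) + thru_4({x, f})` for `x ∥ x′` and `f`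
outside the pair. -/
theorem starNine_of_parallel_left (hn : (gr N).card = 9) (hR : rk N (gr N) = 5)
    (hcf : ∀ y ∈ gr N, rk N ((gr N).erase y) = 5) {x x' f : α} (hx : x ∈ gr N) (hx' : x' ∈ gr N)
    (hxx' : x ≠ x') (hrx : rk N {x} = 1) (hrx' : rk N {x'} = 1) (hcl : x' ∈ clF N {x}) (hf : f ∈ gr N)
    (hfx : f ≠ x) (hfx' : f ≠ x') :
    inCount N 4 x ≤ inCount N 4 f + thruCount N 4 {x, f} := by
  obtain ⟨hgr, hn7, hR4, hcf7, hdis⟩ := minor_hyps_of_parallel hn hR hcf hx hx' hxx' hrx hrx' hcl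
  have hfM : f ∈ gr ((N ／ ({x'} : Set α)) ＼ ({x} : Set α)) := by
    rw [hgr]; exact mem_erase.2 ⟨hfx, mem_erase.2 ⟨hfx', hf⟩⟩
  have hout := outCount_three_le_two_mul_inCount_of_seriesExt hdis hn7 hR4 hcf7 hxx' hfM
  have hP := inCount_add_outCount ((N ／ ({x'} : Set α)) ＼ ({x} : Set α)) 3 f
  have hinx : inCount N 4 x = (biIndepSets ((N ／ ({x'} : Set α)) ＼ ({x} : Set α)) 3).card := by
    rw [← thruCount_singleton, ← insert_empty,
      thruCount_insert_eq_thruCount_minor_of_parallel hxx' hx hx' hrx hrx' hcl (notMem_empty x)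
        (notMem_empty x') (by norm_num), thruCount_empty]
  rw [inCount_eq_thruCount_add_thruCount_of_parallel hx hx' hxx' hrx hcl (e := f) 4,
    thruCount_pair_swap_of_parallel hx hx' hxx' hrx hrx' hcl hfx hfx' 4,
    thruCount_pair_eq_inCount_of_parallel hfx.symm hxx' hfx' hx hx' hrx hrx' hcl (by norm_num), hinx,
    show (4 : ℕ) - 1 = 3 from rfl]
  omega

/-- **(★)₉ WITH A PARALLEL PAIR, `f` IN THE PAIR**: `in_4(e) ≤ in_4(x) + thru_4({e, x})` for `x ∥ x′` and `e`
outside the pair — `in_4(e) = 2 · thru_4({x, e})` by the swap and `thru_4({x, e}) ≤ in_4(x)`. -/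
theorem starNine_of_parallel_right (hn : (gr N).card = 9) (hR : rk N (gr N) = 5)
    (hcf : ∀ y ∈ gr N, rk N ((gr N).erase y) = 5) {x x' e : α} (hx : x ∈ gr N) (hx' : x' ∈ gr N)
    (hxx' : x ≠ x') (hrx : rk N {x} = 1) (hrx' : rk N {x'} = 1) (hcl : x' ∈ clF N {x}) (he : e ∈ gr N)
    (hex : e ≠ x) (hex' : e ≠ x') :
    inCount N 4 e ≤ inCount N 4 x + thruCount N 4 {e, x} := by
  obtain ⟨hgr, hn7, hR4, hcf7, hdis⟩ := minor_hyps_of_parallel hn hR hcf hx hx' hxx' hrx hrx' hcl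
  have heM : e ∈ gr ((N ／ ({x'} : Set α)) ＼ ({x} : Set α)) := by
    rw [hgr]; exact mem_erase.2 ⟨hex, mem_erase.2 ⟨hex', he⟩⟩
  have hP := inCount_add_outCount ((N ／ ({x'} : Set α)) ＼ ({x} : Set α)) 3 e
  have hinx : inCount N 4 x = (biIndepSets ((N ／ ({x'} : Set α)) ＼ ({x} : Set α)) 3).card := by
    rw [← thruCount_singleton, ← insert_empty,
      thruCount_insert_eq_thruCount_minor_of_parallel hxx' hx hx' hrx hrx' hcl (notMem_empty x)
        (notMem_empty x') (by norm_num), thruCount_empty]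
  have hcomm : ({e, x} : Finset α) = {x, e} := pair_comm e x
  rw [hcomm, inCount_eq_thruCount_add_thruCount_of_parallel hx hx' hxx' hrx hcl (e := e) 4,
    thruCount_pair_swap_of_parallel hx hx' hxx' hrx hrx' hcl hex hex' 4,
    thruCount_pair_eq_inCount_of_parallel hex.symm hxx' hex' hx hx' hrx hrx' hcl (by norm_num), hinx,
    show (4 : ℕ) - 1 = 3 from rfl]
  omega

/-- **(★)₉ ON THE PARALLEL PAIR ITSELF**: `in_4(x) ≤ in_4(x′) + thru_4({x, x′})` — the swap gives
`in_4(x) = in_4(x′)`. -/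
theorem starNine_of_parallel_self {x x' : α} (hx : x ∈ gr N) (hx' : x' ∈ gr N) (hxx' : x ≠ x')
    (hrx : rk N {x} = 1) (hrx' : rk N {x'} = 1) (hcl : x' ∈ clF N {x}) :
    inCount N 4 x ≤ inCount N 4 x' + thruCount N 4 {x, x'} := by
  have hcl' : x ∈ clF N {x'} := mem_clF_singleton_of_parallel hx hx' hrx hrx' hcl
  have hpair : rk N {x, x'} = 1 := by
    have h := rk_insert_eq hx (singleton_subset_iff.2 hx') (M := N)
    rw [if_pos hcl', hrx'] at h
    exact h
  have h := card_filter_swap_of_parallel hx hx' hxx' hrx hrx' hpair 4 (fun _ => True) (fun _ => Iff.rfl)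
    (fun _ => Iff.rfl)
  unfold inCount
  have e1 : (biIndepSets N 4).filter (fun W => x ∈ W) =
      (biIndepSets N 4).filter (fun W => (True ∧ x' ∉ W) ∧ x ∈ W) := by
    apply filter_congr
    intro W hW
    exact ⟨fun h1 => ⟨⟨trivial, not_mem_of_mem_of_rk_eq_card_of_parallel hx hx' hxx' hrx hcl
      (mem_biIndepSets.1 hW).2.2.1 h1⟩, h1⟩, fun h1 => h1.2⟩
  have e2 : (biIndepSets N 4).filter (fun W => x' ∈ W) =
      (biIndepSets N 4).filter (fun W => (True ∧ x' ∈ W) ∧ x ∉ W) := by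
    apply filter_congr
    intro W hW
    exact ⟨fun h1 => ⟨⟨trivial, h1⟩, not_mem_of_mem_of_rk_eq_card_of_parallel hx' hx hxx'.symm hrx' hcl'
      (mem_biIndepSets.1 hW).2.2.1 h1⟩, fun h1 => h1.1.2⟩
  rw [e1, e2, ← h]
  exact Nat.le_add_right _ _

/-- **THE PARALLEL-PAIR REGIME OF `StarNine`**: on every coloop-free matroid with `#E = 9`, `ρ(E) = 5` and a
parallel pair `x ∥ x′` (two distinct non-loops with `x′ ∈ cl{x}`), `in_4(e) ≤ in_4(f) + thru_4({e, f})` for all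
`e ≠ f` in `E`. -/
theorem starNine_of_parallel (hn : (gr N).card = 9) (hR : rk N (gr N) = 5)
    (hcf : ∀ y ∈ gr N, rk N ((gr N).erase y) = 5) {x x' : α} (hx : x ∈ gr N) (hx' : x' ∈ gr N) (hxx' : x ≠ x')
    (hrx : rk N {x} = 1) (hrx' : rk N {x'} = 1) (hcl : x' ∈ clF N {x}) {e f : α} (he : e ∈ gr N) (hf : f ∈ gr N)
    (hef : e ≠ f) : inCount N 4 e ≤ inCount N 4 f + thruCount N 4 {e, f} := by
  have hcl' : x ∈ clF N {x'} := mem_clF_singleton_of_parallel hx hx' hrx hrx' hcl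
  by_cases hex : e = x
  · subst hex
    by_cases hfx' : f = x'
    · subst hfx'
      exact starNine_of_parallel_self hx hx' hxx' hrx hrx' hcl
    · exact starNine_of_parallel_left hn hR hcf hx hx' hxx' hrx hrx' hcl hf hef.symm hfx'
  by_cases hex' : e = x'
  · subst hex'
    by_cases hfx : f = x
    · subst hfx
      exact starNine_of_parallel_self hx' hx hxx'.symm hrx' hrx hcl'
    · exact starNine_of_parallel_left hn hR hcf hx' hx hxx'.symm hrx' hrx hcl' hf hef.symm hfx
  by_cases hfx : f = x
  · subst hfx
    exact starNine_of_parallel_right hn hR hcf hx hx' hxx' hrx hrx' hcl he hex hex'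
  by_cases hfx' : f = x'
  · subst hfx'
    exact starNine_of_parallel_right hn hR hcf hx' hx hxx'.symm hrx' hrx hcl' he hex' hex
  exact starNine_of_parallel_outside hn hR hcf hx hx' hxx' hrx hrx' hcl he hf hef hex hex' hfx hfx'

end StarNineParB

end PercRepro.Cogirth
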